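import Literature.NumberTheory.Automorphic.LevelActionHidaLemma
import Literature.NumberTheory.Automorphic.LevelActionAnnihilatorTransport
import Literature.NumberTheory.Automorphic.LevelActionCohomologyFinite
import Literature.NumberTheory.Automorphic.HidaTowerLevelsHecke
import HarnessLib

/-!
# Hida's lemma along the Iwahori depth: `res : H^i(U(b,r')) → H^i(U(b,c))` is injective on the ordinary part

Topic `NumberTheory/Automorphic`; namespace `Literature.NumberTheory.Automorphic.BigHeckeGLn.TameLevel`;
definitions with bodies and theorems (no named fact, no `sorry`).

`GL₂` over a number field `K`, tame level `U` maximal above `p`, trivial coefficients `ℤ/p^s`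
(`laCohomology`, `laOrd` of `HidaTowerLevelActionBridge`).  For `1 ≤ r'`, `b ≤ r' ≤ c` the
restriction `res : H^i(U(b,r'), ℤ/p^s) → H^i(U(b,c), ℤ/p^s)` is **injective on the ordinary part
`laOrd = ⋂_{v ∣ p} ⋂ₘ U_{v,1}^m H^i` and maps it into the ordinary part**
(`injOn_resCohomology_laOrd`, `mapsTo_resCohomology_laOrd`), GIVEN the Borel–Serre finiteness of the
cohomology of congruence subgroups (hypothesis `hX`).

Proof: raise the Iwahori depth one place and one step at a time through the mixed levels
`depthLevel b c_• = levelAt (v ↦ Iw_v(b, c_v))`; each step is Hida's lemma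
`bijOn_resCohomology_iInf_range_levelAt` (conditions `C₁`, `C₂` of [KhareThorne2017, Lemma 6.10]),
whose injectivity/surjectivity inputs are automatic for finite modules (`OrdFinite`), and each step
commutes with every `U_{v,1}` (`bijOn_levelAt_heckeElement_of_mem`).

[cite: Hida1994AIF, §2–3] [cite: KhareThorne2017, §6.3, Lemma 6.10]

## References

* H. Hida, Ann. Inst. Fourier 44 (1994), §2–3. [Hida1994AIF]
* C. Khare, J. A. Thorne, Amer. J. Math. 139 (2017), §6.3. [KhareThorne2017]
-/

noncomputable section

open CategoryTheory IsDedekindDomain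
open scoped NumberField Classical

namespace Literature.NumberTheory.Automorphic

namespace BigHeckeGLn

namespace TameLevel

open LevelAction

variable {K : Type} [Field K] [NumberField K] {p : ℕ} [Fact p.Prime] (𝒰 : TameLevel 2 K p)

/-! ### Mixed-depth levels -/

/-- **`U(b, c_•) = levelAt (v ↦ Iw_v(b, c_v))`**: Iwahori factors of depth `c_v` at `v ∣ p`. [folklore] -/
abbrev depthLevel (b : ℕ) (cv : PlacesAbove K p → ℕ) : Subgroup (FiniteAdelicGL 2 K) :=
  𝒰.levelAt fun v => iwahoriLevel 2 v.1 b (cv v)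

/-- `U(b, (c, …, c)) = U(b, c)`. [folklore] -/
theorem depthLevel_const (b c : ℕ) : 𝒰.depthLevel b (fun _ => c) = 𝒰.level b c := rfl

/-- `U(b, c_•)` decreases in `c_•`. [folklore] -/
theorem depthLevel_anti (b : ℕ) {cv cv' : PlacesAbove K p → ℕ} (h : ∀ v, cv v ≤ cv' v) :
    𝒰.depthLevel b cv' ≤ 𝒰.depthLevel b cv :=
  𝒰.levelAt_mono fun v => iwahoriLevel_antitone v.1 le_rfl (h v)

/-- `U(b, c_•)` is open. [folklore] -/
theorem isOpen_depthLevel (b : ℕ) (cv : PlacesAbove K p → ℕ) :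
    IsOpen (𝒰.depthLevel b cv : Set (FiniteAdelicGL 2 K)) :=
  𝒰.isOpen_levelAt _ fun v => isOpen_iwahoriLevel v.1 b (cv v)

/-- `U(b, c_•)` is compact. [folklore] -/
theorem isCompact_depthLevel (b : ℕ) (cv : PlacesAbove K p → ℕ) :
    IsCompact (𝒰.depthLevel b cv : Set (FiniteAdelicGL 2 K)) :=
  𝒰.isCompact_levelAt _ fun v => isOpen_iwahoriLevel v.1 b (cv v)

/-! ### The ordinary part at an arbitrary level -/

/-- The trivial action of `GL₂(𝔸^∞)` on `k/p^s`. [folklore] -/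
abbrev trivMod (k : Type) [CommRing k] (s : ℕ) : (⊤ : Submonoid (FiniteAdelicGL 2 K)) →* Module.End k (modPow k (p : k) s) := 1

/-- **`Ord(U) = ⋂_{v ∣ p} ⋂ₘ U_{v,1}^m H^i(U, ℤ/p^s)`** at an arbitrary level `U`. [cite: KhareThorne2017, §2.4] -/
def ordAt (U : Subgroup (FiniteAdelicGL 2 K)) (s i : ℕ) :
    Submodule ℤ (cohomology (globalEmbedding 2 K) ⊤ (trivMod (K := K) (p := p) ℤ s) U i) :=
  ⨅ (v : PlacesAbove K p) (m : ℕ),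
    LinearMap.range (heckeCohomology (globalEmbedding 2 K) ⊤ (trivMod (K := K) (p := p) ℤ s) U le_top
      (Submonoid.mem_top (heckeElement 2 K v.1 1)) i ^ m)

/-- `laOrd` is `ordAt` of `U(b, c)`. [folklore] -/
theorem laOrd_eq_ordAt (b c s i : ℕ) : 𝒰.laOrd ℤ b c s i = ordAt (𝒰.level b c) s i := rfl

/-! ### One step of Iwahori depth -/

section Step

variable (h𝒰 : 𝒰.IsMaximalAbove)

/-- `H^i(U(b, c_•), ℤ/p^s)` is finite, GIVEN the Borel–Serre finiteness `hX`. [cite: BorelSerre1973, §11.1] -/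
theorem finite_cohomology_depthLevel (hX : BorelSerre1973_finite_groupCohomology_congruenceSubgroup)
    (b : ℕ) (cv : PlacesAbove K p → ℕ) (s i : ℕ) :
    Finite (cohomology (globalEmbedding 2 K) ⊤ (trivMod (K := K) (p := p) ℤ s) (𝒰.depthLevel b cv) i) := by
  haveI := finite_modPow_int p s
  exact LevelAction.finite_cohomology_two_of_borelSerre hX K (𝒰.depthLevel b cv) (𝒰.isOpen_depthLevel b cv)
    (𝒰.isCompact_depthLevel b cv) ⊤ le_top _ i

include h𝒰 in
/-- `res : H^i(U(b, c_•)) → H^i(U(b, c'_•))` (`c_• ≤ c'_•`) commutes with every `U_{v,1}`, hence maps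
`Ord` into `Ord`. [cite: KhareThorne2017, §6.2, Lemma 6.5 (2)] -/
theorem mapsTo_resCohomology_ordAt_depthLevel (b : ℕ) {cv cv' : PlacesAbove K p → ℕ} (h : ∀ v, cv v ≤ cv' v)
    (h1 : ∀ v, 1 ≤ max b (cv v)) (s i : ℕ) :
    Set.MapsTo (resCohomology (globalEmbedding 2 K) ⊤ (trivMod (K := K) (p := p) ℤ s) (𝒰.depthLevel_anti b h) i).hom
      (SetLike.coe (ordAt (𝒰.depthLevel b cv) s i)) (SetLike.coe (ordAt (𝒰.depthLevel b cv') s i)) := by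
  intro x hx
  simp only [ordAt, SetLike.mem_coe, Submodule.mem_iInf] at hx ⊢
  intro v
  have hcomm := congrArg ModuleCat.Hom.hom (resCohomology_heckeCohomology_of_bijOn (globalEmbedding 2 K) ⊤
    (trivMod (K := K) (p := p) ℤ s) le_top le_top
    (𝒰.depthLevel_anti b h : 𝒰.depthLevel b cv' ≤ 𝒰.depthLevel b cv) (Submonoid.mem_top (heckeElement 2 K v.1 1))
    (𝒰.bijOn_levelAt_heckeElement_of_mem h𝒰 (fun w => iwahoriLevel_antitone w.1 le_rfl (h w)) v.2 (h1 v)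
      rfl rfl 1) i)
  rw [ModuleCat.hom_comp, ModuleCat.hom_comp] at hcomm
  exact (Submodule.mem_iInf _).1 (mapsTo_iInf_range_pow_of_comp_eq hcomm.symm ((Submodule.mem_iInf _).2 (hx v))) 

include h𝒰 in
/-- **One step of Hida's lemma**: `res : H^i(U(b, c_•)) → H^i(U(b, c_• + δ_{v₀}))` is injective on
`⋂ₘ U_{v₀,1}^m H^i` (`1 ≤ c_{v₀}`, `b ≤ c_{v₀} + 1`; Borel–Serre finiteness `hX`).
[cite: KhareThorne2017, §6.3, Lemma 6.10] -/
theorem injOn_resCohomology_update (hX : BorelSerre1973_finite_groupCohomology_congruenceSubgroup) (b : ℕ)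
    (cv : PlacesAbove K p → ℕ) (v₀ : PlacesAbove K p)
    (hc : 1 ≤ cv v₀) (hbc : b ≤ cv v₀ + 1) (s i : ℕ)
    (hle : 𝒰.depthLevel b (Function.update cv v₀ (cv v₀ + 1)) ≤ 𝒰.depthLevel b cv) :
    Set.InjOn (resCohomology (globalEmbedding 2 K) ⊤ (trivMod (K := K) (p := p) ℤ s) hle i).hom
      (SetLike.coe (⨅ m : ℕ, LinearMap.range (heckeCohomology (globalEmbedding 2 K) ⊤ (trivMod (K := K) (p := p) ℤ s)
        (𝒰.depthLevel b cv) le_top (Submonoid.mem_top (heckeElement 2 K v₀.1 1)) i ^ m) : Submodule ℤ _)) := by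
  classical
  haveI := 𝒰.finite_cohomology_depthLevel hX b cv s i
  haveI := 𝒰.finite_cohomology_depthLevel hX b (Function.update cv v₀ (cv v₀ + 1)) s i
  have hΛ'v : (fun w : PlacesAbove K p => iwahoriLevel 2 w.1 b (Function.update cv v₀ (cv v₀ + 1) w)) ⟨v₀.1, v₀.2⟩ =
      iwahoriLevel 2 v₀.1 b (cv v₀ + 1) := by
    simp only [Subtype.coe_eta, Function.update_self]
  have hΛ' : ∀ w : PlacesAbove K p, w.1 ≠ v₀.1 →
      (fun w : PlacesAbove K p => iwahoriLevel 2 w.1 b (Function.update cv v₀ (cv v₀ + 1) w)) w =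
        (fun w : PlacesAbove K p => iwahoriLevel 2 w.1 b (cv w)) w := fun w hw => by
    simp only [Function.update_of_ne (fun h => hw (congrArg Subtype.val h))]
  exact (bijOn_resCohomology_iInf_range_levelAt (𝒰 := 𝒰) v₀.2 (b := b) (c := cv v₀)
    (Λ := fun w : PlacesAbove K p => iwahoriLevel 2 w.1 b (cv w))
    (Λ' := fun w : PlacesAbove K p => iwahoriLevel 2 w.1 b (Function.update cv v₀ (cv v₀ + 1) w))
    rfl hΛ'v hΛ' (globalEmbedding 2 K) ⊤ (trivMod (K := K) (p := p) ℤ s) le_top le_top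
    (Submonoid.mem_top _) h𝒰 hc hbc i (OrdFinite.bijOn_iInf_range_pow _).injOn
    (OrdFinite.bijOn_iInf_range_pow _).surjOn).injOn

end Step

/-! ### Iterating: the invariant -/

omit [Fact p.Prime] in
/-- `res` composes. [folklore] -/
theorem resCohomology_hom_comp {U U' U'' : Subgroup (FiniteAdelicGL 2 K)} (hle : U' ≤ U) (hle' : U'' ≤ U') (s i : ℕ)
    (x : cohomology (globalEmbedding 2 K) ⊤ (trivMod (K := K) (p := p) ℤ s) U i) :
    (resCohomology (globalEmbedding 2 K) ⊤ (trivMod (K := K) (p := p) ℤ s) (hle'.trans hle) i).hom x =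
      (resCohomology (globalEmbedding 2 K) ⊤ (trivMod (K := K) (p := p) ℤ s) hle' i).hom
        ((resCohomology (globalEmbedding 2 K) ⊤ (trivMod (K := K) (p := p) ℤ s) hle i).hom x) := by
  have h : resRepHom (globalEmbedding 2 K) ⊤ (trivMod (K := K) (p := p) ℤ s) (hle'.trans hle) =
      resRepHom (globalEmbedding 2 K) ⊤ (trivMod (K := K) (p := p) ℤ s) hle ≫
        resRepHom (globalEmbedding 2 K) ⊤ (trivMod (K := K) (p := p) ℤ s) hle' := rfl
  dsimp only [resCohomology]
  rw [h, groupCohomology.map_id_comp, ModuleCat.comp_apply]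

omit [Fact p.Prime] in
/-- `res` along `le_rfl` is the identity. [folklore] -/
theorem resCohomology_hom_refl {U : Subgroup (FiniteAdelicGL 2 K)} (s i : ℕ)
    (x : cohomology (globalEmbedding 2 K) ⊤ (trivMod (K := K) (p := p) ℤ s) U i) :
    (resCohomology (globalEmbedding 2 K) ⊤ (trivMod (K := K) (p := p) ℤ s) (le_refl U) i).hom x = x := by
  have h : resRepHom (globalEmbedding 2 K) ⊤ (trivMod (K := K) (p := p) ℤ s) (le_refl U) = 𝟙 _ := rfl
  dsimp only [resCohomology]
  rw [h, groupCohomology.map_id]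
  rfl

/-- The invariant: `res : H^i(U(b, r')) → H^i(U(b, c_•))` maps `Ord` into `Ord` injectively. [folklore] -/
def ResGood (b r' : ℕ) (cv : PlacesAbove K p → ℕ) (s i : ℕ) : Prop :=
  ∃ hle : 𝒰.depthLevel b cv ≤ 𝒰.level b r',
    Set.MapsTo (resCohomology (globalEmbedding 2 K) ⊤ (trivMod (K := K) (p := p) ℤ s) hle i).hom
        (SetLike.coe (ordAt (𝒰.level b r') s i)) (SetLike.coe (ordAt (𝒰.depthLevel b cv) s i)) ∧
      Set.InjOn (resCohomology (globalEmbedding 2 K) ⊤ (trivMod (K := K) (p := p) ℤ s) hle i).hom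
        (SetLike.coe (ordAt (𝒰.level b r') s i))

/-- Base of the induction. [folklore] -/
theorem resGood_const (b r' s i : ℕ) : 𝒰.ResGood b r' (fun _ => r') s i := by
  change ∃ hle : 𝒰.level b r' ≤ 𝒰.level b r',
    Set.MapsTo (resCohomology (globalEmbedding 2 K) ⊤ (trivMod (K := K) (p := p) ℤ s) hle i).hom
        (SetLike.coe (ordAt (𝒰.level b r') s i)) (SetLike.coe (ordAt (𝒰.level b r') s i)) ∧
      Set.InjOn (resCohomology (globalEmbedding 2 K) ⊤ (trivMod (K := K) (p := p) ℤ s) hle i).hom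
        (SetLike.coe (ordAt (𝒰.level b r') s i))
  exact ⟨le_rfl, fun x hx => by rwa [SetLike.mem_coe, resCohomology_hom_refl], fun x _ y _ h => by
    rwa [resCohomology_hom_refl, resCohomology_hom_refl] at h⟩

section Induction

variable (h𝒰 : 𝒰.IsMaximalAbove)
include h𝒰

/-- One step preserves the invariant. [cite: KhareThorne2017, §6.3, Lemma 6.10] -/
theorem resGood_update (hX : BorelSerre1973_finite_groupCohomology_congruenceSubgroup) {b r' : ℕ}
    (hr' : 1 ≤ r') (hbr' : b ≤ r') {cv : PlacesAbove K p → ℕ}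
    (hcv : ∀ v, r' ≤ cv v) (v₀ : PlacesAbove K p) {s i : ℕ} (h : 𝒰.ResGood b r' cv s i) :
    𝒰.ResGood b r' (Function.update cv v₀ (cv v₀ + 1)) s i := by
  classical
  obtain ⟨hle, hmaps, hinj⟩ := h
  have hmono : ∀ v, cv v ≤ Function.update cv v₀ (cv v₀ + 1) v := fun v => by
    by_cases hv : v = v₀
    · subst hv; rw [Function.update_self]; exact Nat.le_succ _
    · rw [Function.update_of_ne hv]
  have hle' : 𝒰.depthLevel b (Function.update cv v₀ (cv v₀ + 1)) ≤ 𝒰.depthLevel b cv := 𝒰.depthLevel_anti b hmono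
  refine ⟨hle'.trans hle, fun x hx => ?_, ?_⟩
  · rw [SetLike.mem_coe, resCohomology_hom_comp hle hle']
    exact 𝒰.mapsTo_resCohomology_ordAt_depthLevel h𝒰 b hmono
      (fun v => le_max_of_le_right (hr'.trans (hcv v))) s i (hmaps hx)
  · have hfun : ((resCohomology (globalEmbedding 2 K) ⊤ (trivMod (K := K) (p := p) ℤ s) (hle'.trans hle) i).hom :
        _ → _) = (resCohomology (globalEmbedding 2 K) ⊤ (trivMod (K := K) (p := p) ℤ s) hle' i).hom ∘
          (resCohomology (globalEmbedding 2 K) ⊤ (trivMod (K := K) (p := p) ℤ s) hle i).hom :=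
      funext fun x => resCohomology_hom_comp hle hle' s i x
    rw [hfun]
    have hstep := 𝒰.injOn_resCohomology_update h𝒰 hX b cv v₀ (hr'.trans (hcv v₀))
      (hbr'.trans ((hcv v₀).trans (Nat.le_succ _))) s i hle'
    refine hstep.comp hinj (fun x hx => ?_)
    have hx' := hmaps hx
    simp only [ordAt, SetLike.mem_coe, Submodule.mem_iInf] at hx' ⊢
    exact fun m => hx' v₀ m

/-- Raising one place by `n` steps. [folklore] -/
theorem resGood_update_add (hX : BorelSerre1973_finite_groupCohomology_congruenceSubgroup) {b r' : ℕ}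
    (hr' : 1 ≤ r') (hbr' : b ≤ r') {cv : PlacesAbove K p → ℕ}
    (hcv : ∀ v, r' ≤ cv v) (v₀ : PlacesAbove K p) {s i : ℕ} (h : 𝒰.ResGood b r' cv s i) (n : ℕ) :
    𝒰.ResGood b r' (Function.update cv v₀ (cv v₀ + n)) s i := by
  induction n with
  | zero => rwa [add_zero, Function.update_eq_self]
  | succ n ih =>
    have hcv' : ∀ v, r' ≤ Function.update cv v₀ (cv v₀ + n) v := fun v => by
      by_cases hv : v = v₀
      · subst hv; rw [Function.update_self]; exact (hcv v).trans (Nat.le_add_right _ _)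
      · rw [Function.update_of_ne hv]; exact hcv v
    have hstep := 𝒰.resGood_update h𝒰 hX hr' hbr' hcv' v₀ ih
    rwa [Function.update_idem, Function.update_self, add_assoc] at hstep

/-- Raising a set of places to depth `c`. [folklore] -/
theorem resGood_piecewise (hX : BorelSerre1973_finite_groupCohomology_congruenceSubgroup) {b r' c : ℕ}
    (hr' : 1 ≤ r') (hbr' : b ≤ r') (hc : r' ≤ c) (s i : ℕ)
    (T : Finset (PlacesAbove K p)) :
    𝒰.ResGood b r' (fun v => if v ∈ T then c else r') s i := by
  classical
  induction T using Finset.induction_on with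
  | empty => simpa using 𝒰.resGood_const b r' s i
  | @insert v₀ T hv₀ ih =>
    have h := 𝒰.resGood_update_add h𝒰 hX hr' hbr' (cv := fun v => if v ∈ T then c else r')
      (fun v => by split_ifs <;> omega) v₀ ih (c - r')
    have heq : Function.update (fun v => if v ∈ T then c else r') v₀ ((if v₀ ∈ T then c else r') + (c - r')) =
        fun v => if v ∈ insert v₀ T then c else r' := by
      funext v
      by_cases hv : v = v₀
      · subst hv
        rw [Function.update_self, if_neg hv₀, if_pos (Finset.mem_insert_self _ _), Nat.add_sub_cancel' hc]
      · rw [Function.update_of_ne hv]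
        simp [Finset.mem_insert, hv]
    rwa [heq] at h

/-- **Hida's lemma along the Iwahori depth: `res : H^i(U(b,r'), ℤ/p^s) → H^i(U(b,c), ℤ/p^s)` is
injective on `laOrd` and maps it into `laOrd`** (`1 ≤ r'`, `b ≤ r' ≤ c`; Borel–Serre finiteness).
[cite: Hida1994AIF, §3] [cite: KhareThorne2017, §6.3, Lemma 6.10] -/
theorem injOn_resCohomology_laOrd (hX : BorelSerre1973_finite_groupCohomology_congruenceSubgroup) {b r' c : ℕ}
    (hr' : 1 ≤ r') (hbr' : b ≤ r') (hc : r' ≤ c) (s i : ℕ) :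
    Set.InjOn (resCohomology (globalEmbedding 2 K) ⊤ (trivMod (K := K) (p := p) ℤ s)
        (𝒰.level_antitone le_rfl hc : 𝒰.level b c ≤ 𝒰.level b r') i).hom
        (SetLike.coe (𝒰.laOrd ℤ b r' s i)) ∧
      Set.MapsTo (resCohomology (globalEmbedding 2 K) ⊤ (trivMod (K := K) (p := p) ℤ s)
        (𝒰.level_antitone le_rfl hc : 𝒰.level b c ≤ 𝒰.level b r') i).hom
        (SetLike.coe (𝒰.laOrd ℤ b r' s i)) (SetLike.coe (𝒰.laOrd ℤ b c s i)) := by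
  classical
  have h := 𝒰.resGood_piecewise h𝒰 hX hr' hbr' hc s i Finset.univ
  simp only [Finset.mem_univ, if_true] at h
  obtain ⟨hle, hmaps, hinj⟩ := h
  exact ⟨hinj, hmaps⟩

end Induction

end TameLevel

end BigHeckeGLn

end Literature.NumberTheory.Automorphic
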